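import Mathlib.Analysis.Calculus.ContDiff.Deriv
import Mathlib.Analysis.Calculus.ContDiff.Operations
import Literature.Analysis.FluidPDE.CompressibleEulerImplosionMonatomicAlgebra
import HarnessLib

/-!
# Buckmaster–Cao-Labora–Gómez-Serrano at `γ = 5/3`: regularity of solutions away from the sonic lines

Topic `Literature/Analysis/FluidPDE`; namespace
`Literature.Analysis.FluidPDE.BuckmasterCaolaboraGomezserrano2025.Monatomic`. Companion of
`CompressibleEulerImplosion.lean` (named fact `BuckmasterCaolaboraGomezserrano2025_thm11_monatomic`,
THEOREM 1.1 of T. Buckmaster, G. Cao-Labora, J. Gómez-Serrano, *Smooth imploding solutions for 3D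
compressible fluids*, Forum Math. Pi 13 (2025) e6, arXiv:2208.09445, at `γ = 5/3`, `α = 1/3`)
and of `CompressibleEulerImplosionMonatomicAlgebra.lean` (Brick B: `DW`, `DZ`, `NW`, `NZ`).
Brick A-reg of the discharge plan: the elementary bootstrap behind the word "smooth" in
Proposition 1.6 ("There exists a smooth solution `W(ξ), Z(ξ)` … to (1.8)") away from
`{D_W = 0} ∪ {D_Z = 0}`: the field `(N_W/D_W, N_Z/D_Z)` of the autonomous system (1.8) is `C^∞`
where `D_W D_Z ≠ 0`, so every differentiable solution on an open set on which `D_W D_Z ≠ 0`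
along it is `C^∞` there (`contDiffOn_of_field`). In the `ζ` variable this feeds hypothesis
`h_sm` (smoothness at `ζ ≠ 0`, away from the sonic point) of the glue theorem
`thm11_monatomic_of_profile`; smoothness AT the sonic point `P_s` is the analytic expansion of
Prop. 2.3, not this file. Theorems only. [cite: BuckmasterCaolaboraGomezserrano2025, Prop. 1.6, §1.3 eq. (1.8)]
-/

noncomputable section

open Set Filter Topology
open scoped ContDiff

namespace Literature.Analysis.FluidPDE

namespace BuckmasterCaolaboraGomezserrano2025

namespace Monatomic

/-- If `W, Z` are `Cⁿ` on `S` and `D_W ≠ 0` along them, then `ξ ↦ N_W(W,Z)/D_W(W,Z)` is `Cⁿ` on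
`S`. [folklore] -/
theorem contDiffOn_NW_div_DW {r : ℝ} {W Z : ℝ → ℝ} {S : Set ℝ} {n : WithTop ℕ∞}
    (hW : ContDiffOn ℝ n W S) (hZ : ContDiffOn ℝ n Z S) (hDW : ∀ ξ ∈ S, DW (W ξ) (Z ξ) ≠ 0) :
    ContDiffOn ℝ n (fun ξ => NW r (W ξ) (Z ξ) / DW (W ξ) (Z ξ)) S := by
  unfold NW DW
  refine ContDiffOn.div ?_ ?_ (by simpa [DW] using hDW)
  · exact ((contDiffOn_const.add ((contDiffOn_const.mul hW).div_const _)).add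
      (hZ.div_const _)).neg.mul hW |>.add ((hZ.pow 2).div_const _)
  · exact contDiffOn_const.add (((contDiffOn_const.mul hW).add hZ).div_const _)

/-- If `W, Z` are `Cⁿ` on `S` and `D_Z ≠ 0` along them, then `ξ ↦ N_Z(W,Z)/D_Z(W,Z)` is `Cⁿ` on
`S`. [folklore] -/
theorem contDiffOn_NZ_div_DZ {r : ℝ} {W Z : ℝ → ℝ} {S : Set ℝ} {n : WithTop ℕ∞}
    (hW : ContDiffOn ℝ n W S) (hZ : ContDiffOn ℝ n Z S) (hDZ : ∀ ξ ∈ S, DZ (W ξ) (Z ξ) ≠ 0) :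
    ContDiffOn ℝ n (fun ξ => NZ r (W ξ) (Z ξ) / DZ (W ξ) (Z ξ)) S := by
  unfold NZ DZ
  refine ContDiffOn.div ?_ ?_ (by simpa [DZ] using hDZ)
  · exact ((contDiffOn_const.add (hW.div_const _)).add
      ((contDiffOn_const.mul hZ).div_const _)).neg.mul hZ |>.add ((hW.pow 2).div_const _)
  · exact contDiffOn_const.add ((hW.add (contDiffOn_const.mul hZ)).div_const _)

/-- **Bootstrap.** A differentiable solution `(W, Z)` of the autonomous system (1.8) (`α = 1/3`,
`W′ = N_W/D_W`, `Z′ = N_Z/D_Z`) on an open set `S` on which `D_W D_Z ≠ 0` along the solution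
is `C^∞` on `S`. [cite: BuckmasterCaolaboraGomezserrano2025, Prop. 1.6] -/
theorem contDiffOn_of_field {r : ℝ} {W Z : ℝ → ℝ} {S : Set ℝ} (hS : IsOpen S)
    (hW : ∀ ξ ∈ S, HasDerivAt W (NW r (W ξ) (Z ξ) / DW (W ξ) (Z ξ)) ξ)
    (hZ : ∀ ξ ∈ S, HasDerivAt Z (NZ r (W ξ) (Z ξ) / DZ (W ξ) (Z ξ)) ξ)
    (hDW : ∀ ξ ∈ S, DW (W ξ) (Z ξ) ≠ 0) (hDZ : ∀ ξ ∈ S, DZ (W ξ) (Z ξ) ≠ 0) :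
    ContDiffOn ℝ ∞ W S ∧ ContDiffOn ℝ ∞ Z S := by
  have hWd : DifferentiableOn ℝ W S := fun ξ hξ => (hW ξ hξ).differentiableAt.differentiableWithinAt
  have hZd : DifferentiableOn ℝ Z S := fun ξ hξ => (hZ ξ hξ).differentiableAt.differentiableWithinAt
  have hdW : ∀ ξ ∈ S, deriv W ξ = NW r (W ξ) (Z ξ) / DW (W ξ) (Z ξ) := fun ξ hξ => (hW ξ hξ).deriv
  have hdZ : ∀ ξ ∈ S, deriv Z ξ = NZ r (W ξ) (Z ξ) / DZ (W ξ) (Z ξ) := fun ξ hξ => (hZ ξ hξ).deriv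
  suffices H : ∀ n : ℕ, ContDiffOn ℝ n W S ∧ ContDiffOn ℝ n Z S from
    ⟨contDiffOn_infty.mpr fun n => (H n).1, contDiffOn_infty.mpr fun n => (H n).2⟩
  intro n
  induction n with
  | zero =>
    exact ⟨contDiffOn_zero.mpr hWd.continuousOn, contDiffOn_zero.mpr hZd.continuousOn⟩
  | succ n ih =>
    have h1 : ContDiffOn ℝ n (deriv W) S :=
      (contDiffOn_NW_div_DW ih.1 ih.2 hDW).congr fun ξ hξ => hdW ξ hξ
    have h2 : ContDiffOn ℝ n (deriv Z) S :=
      (contDiffOn_NZ_div_DZ ih.1 ih.2 hDZ).congr fun ξ hξ => hdZ ξ hξ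
    have hcast : ((n + 1 : ℕ) : WithTop ℕ∞) = (n : WithTop ℕ∞) + 1 := by push_cast; rfl
    rw [hcast]
    refine ⟨(contDiffOn_succ_iff_deriv_of_isOpen hS).mpr ⟨hWd, ?_, h1⟩,
      (contDiffOn_succ_iff_deriv_of_isOpen hS).mpr ⟨hZd, ?_, h2⟩⟩
    · intro h; exact absurd h (by simp)
    · intro h; exact absurd h (by simp)

/-- Pointwise form: such a solution is `C^∞` at every point of `S`. [cite: BuckmasterCaolaboraGomezserrano2025, Prop. 1.6] -/
theorem contDiffAt_of_field {r : ℝ} {W Z : ℝ → ℝ} {S : Set ℝ} (hS : IsOpen S)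
    (hW : ∀ ξ ∈ S, HasDerivAt W (NW r (W ξ) (Z ξ) / DW (W ξ) (Z ξ)) ξ)
    (hZ : ∀ ξ ∈ S, HasDerivAt Z (NZ r (W ξ) (Z ξ) / DZ (W ξ) (Z ξ)) ξ)
    (hDW : ∀ ξ ∈ S, DW (W ξ) (Z ξ) ≠ 0) (hDZ : ∀ ξ ∈ S, DZ (W ξ) (Z ξ) ≠ 0) {ξ : ℝ} (hξ : ξ ∈ S) :
    ContDiffAt ℝ ∞ W ξ ∧ ContDiffAt ℝ ∞ Z ξ :=
  have h := contDiffOn_of_field hS hW hZ hDW hDZ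
  ⟨h.1.contDiffAt (hS.mem_nhds hξ), h.2.contDiffAt (hS.mem_nhds hξ)⟩

end Monatomic

end BuckmasterCaolaboraGomezserrano2025

end Literature.Analysis.FluidPDE
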